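import Literature.AlgebraicGeometry.Resolution.NearPointsCurveCentre
import Literature.AlgebraicGeometry.Resolution.NearPointsLocus
import Literature.AlgebraicGeometry.Resolution.OrderSemicontinuity
import Literature.AlgebraicGeometry.Resolution.J2Blowup
import Literature.AlgebraicGeometry.Resolution.RegularCentreBlowupSeqIntegral
import HarnessLib

/-!
# `τ(x) = 2` and `Y` a curve: `Y` and `Σ` coincide locally at `x` (CoP1, Lemma 4.3 (2))

Topic: `Literature/AlgebraicGeometry/Resolution`. [CoP1] = Cossart–Piltant, J. Algebra 320
(2008) 1051–1082, Lemma 4.3 (2), p. 8: "If `τ(x) = 2` and `Y` is a curve, then no `x′ ∈ q⁻¹(x)`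
is near `x`. Moreover `Y` and `Σ` coincide locally at `x`." The first sentence is
`NearPointsCurveCentre.lean`. PROVED here, the second sentence in the form: **every point `z` of
`Σ = {ord = μ}` specializing to `x` lies on `Y`** (so every irreducible component of `Σ`
through `x` is contained in, hence equal to, the curve `Y`). The argument: if `z ∈ Σ ∖ Y`
specializes to `x`, its unique preimage `z′` under the blowing up `q` along `Y` has
`ord_{z′} J′ = ord_z J = μ` (`NearPointsLocus.lean`); `q` is closed, so some `x′` in the
closure of `z′` lies over `x`; orders are upper semicontinuous on the regular J-2 scheme `X′`
(`OrderSemicontinuity.lean`, `J2Blowup.lean`) and bounded by `μ` over `Y`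
(`RegularCentreBlowupOrder.lean`), so `x′` is near `x` — contradicting the first sentence.

* `IsBlowup.exists_preimage_of_not_mem` — a point off the centre has a preimage;
* `IsBlowup.exists_isNear_of_idealOrder_eq_of_specializes` — a point of `Σ ∖ Y` specializing to
  `x` yields a near point over `x`; `IsBlowup.mem_centre_of_forall_not_isNear` — so if no point
  over `x` is near, `Σ` and `Y` coincide at `x` in the above sense (the mechanism also behind
  "`x` is an isolated point of `Σ`" in Lemma 4.3 (1), given Hironaka's theorem);
* `IsBlowup.mem_centre_of_idealOrder_eq_of_specializes` — **Lemma 4.3 (2), second sentence.**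

## Sources

* V. Cossart, O. Piltant, J. Algebra 320 (2008) 1051–1082, Lemma 4.3 (2), p. 8.
  [CossartPiltant2008]
-/

noncomputable section

open CategoryTheory CategoryTheory.Limits AlgebraicGeometry TopologicalSpace IsLocalRing

namespace Literature.AlgebraicGeometry.Resolution

universe u

open Scheme.IdealSheafData

variable {X X' : Scheme.{u}} {π : X' ⟶ X}

/-- A point off the centre of a blowing up has a preimage (the blowing up is an isomorphism
over the complement of the centre). [folklore] -/
theorem IsBlowup.exists_preimage_of_not_mem {C : X.IdealSheafData} (hπ : IsBlowup π C) {z : X}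
    (hz : z ∉ C.support) : ∃ z' : X', π z' = z := by
  set W₀ : X.Opens := ⟨(C.support : Set X)ᶜ, C.support.isClosed.isOpen_compl⟩ with hW₀
  haveI : IsIso (π ∣_ W₀) := hπ.isIso_compl
  obtain ⟨z', hz'⟩ := (ConcreteCategory.bijective_of_isIso ((π ∣_ W₀).base)).2 ⟨z, hz⟩
  refine ⟨z'.1, ?_⟩
  have := congrArg Subtype.val hz'
  rwa [morphismRestrict_base_coe] at this

/-- **Near points over the special point of a curve of `Σ` leaving the centre.** Let `X` be
integral, regular, Noetherian with J-2 affine rings (a stage), `J ≠ 0` with `ord J ≤ μ` on `X`,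
`Y ⊆ Σ = {ord = μ}` a regular centre and `π` a blowing up along `Y`. If a point `z ∈ Σ ∖ Y`
specializes to `x`, then some point `x′` over `x` is near: the preimage `z′` of `z` has
`ord_{z′} J′ = μ`, `π` is closed so some `x′` in the closure of `z′` lies over `x`, and
`μ ≤ ord_{x′} J′ ≤ μ` by upper semicontinuity and (a). (The mechanism behind "Moreover …" in
[CoP1] Lemma 4.3 (1)–(2).) [cite: CossartPiltant2008, Lemma 4.3] -/
theorem IsBlowup.exists_isNear_of_idealOrder_eq_of_specializes [IsIntegral X] [IsNoetherian X]
    (hX : Scheme.IsRegular X) (hJ2 : ∀ U : X.affineOpens, IsJ2Ring Γ(X, U)) {Y : Closeds X}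
    (hreg : Scheme.IsRegular (vanishingIdeal Y).subscheme) (hπ : IsBlowup π (vanishingIdeal Y))
    {J : X.IdealSheafData} (hJ : J ≠ ⊥) {μ : ℕ}
    (hY : ∀ y ∈ (Y : Set X), idealOrder J y = μ) (hJμ : ∀ y : X, idealOrder J y ≤ μ) {x z : X}
    (hzY : z ∉ (Y : Set X)) (hz : idealOrder J z = μ) (hzx : z ⤳ x) :
    ∃ x' : X', π x' = x ∧ IsNear π (vanishingIdeal Y) J μ x' := by
  haveI : IsProper π := hπ.isProper
  haveI : IsLocallyNoetherian X' := LocallyOfFiniteType.isLocallyNoetherian π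
  haveI : IsNoetherian X' := by
    haveI := QuasiCompact.compactSpace_of_compactSpace π
    exact {}
  have hX' : Scheme.IsRegular X' := hπ.isRegular_of_isRegular_subscheme hX hreg
  have hJ2' : ∀ V : X'.affineOpens, IsJ2Ring Γ(X', V) := hπ.isJ2Ring_sections hJ2
  -- the preimage `z'` of `z`, of order `μ`
  have hzC : z ∉ (vanishingIdeal Y).support := by
    rwa [← SetLike.mem_coe, coe_support_vanishingIdeal]
  obtain ⟨z', hz'⟩ := hπ.exists_preimage_of_not_mem hzC
  have hordz' : idealOrder (controlledTransform π (vanishingIdeal Y) J μ) z' = μ := by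
    rw [hπ.idealOrder_controlledTransform_eq_of_not_mem_support J μ (hz' ▸ hzC :
      π z' ∉ (vanishingIdeal Y).support), hz']
    exact hz
  -- a point `x'` over `x` in the closure of `z'`
  have hxcl : x ∈ closure (π.base '' {z'}) := by
    rw [Set.image_singleton, show π.base z' = z from hz', ← specializes_iff_mem_closure]
    exact hzx
  obtain ⟨x', hx'cl, hx'⟩ := π.isClosedMap.closure_image_subset _ hxcl
  -- `x'` is near: `μ ≤ ord_{x'} J'` by upper semicontinuity, `≤ μ` by (a)
  have hC : (vanishingIdeal Y).support ≠ ⊤ := fun htop => hzC (htop ▸ trivial)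
  have hVne : vanishingIdeal Y ≠ ⊥ := fun h => hC (by rw [h, Scheme.IdealSheafData.support_bot])
  haveI : IsIntegral X' := hπ.isIntegral hVne
  have hne : controlledTransform π (vanishingIdeal Y) J μ ≠ ⊥ := by
    intro hbot
    have h := hπ.comap_ne_bot hC hJ
    exact h (le_bot_iff.mp (hbot ▸ comap_le_controlledTransform π (vanishingIdeal Y) J μ))
  have hclosed := isClosed_setOf_le_idealOrder_of_isJ2 hX' hJ2' hne (μ : ℕ∞)
  have hx'ge : (μ : ℕ∞) ≤ idealOrder (controlledTransform π (vanishingIdeal Y) J μ) x' := by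
    have hsub : closure ({z'} : Set X') ⊆
        {y' : X' | (μ : ℕ∞) ≤ idealOrder (controlledTransform π (vanishingIdeal Y) J μ) y'} :=
      hclosed.closure_subset_iff.mpr (Set.singleton_subset_iff.mpr hordz'.ge)
    exact hsub hx'cl
  have hx'le := hπ.idealOrder_controlledTransform_le_of_forall hX hreg hY hJμ x'
  exact ⟨x', hx', isNear_iff.mpr (le_antisymm hx'le (by exact_mod_cast hx'ge))⟩

/-- Contrapositive packaging: **if no point over `x` is near, then every point of `Σ`
specializing to `x` lies on the centre `Y`** ("`Y` and `Σ` coincide locally at `x`").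
[cite: CossartPiltant2008, Lemma 4.3] -/
theorem IsBlowup.mem_centre_of_forall_not_isNear [IsIntegral X] [IsNoetherian X]
    (hX : Scheme.IsRegular X) (hJ2 : ∀ U : X.affineOpens, IsJ2Ring Γ(X, U)) {Y : Closeds X}
    (hreg : Scheme.IsRegular (vanishingIdeal Y).subscheme) (hπ : IsBlowup π (vanishingIdeal Y))
    {J : X.IdealSheafData} (hJ : J ≠ ⊥) {μ : ℕ}
    (hY : ∀ y ∈ (Y : Set X), idealOrder J y = μ) (hJμ : ∀ y : X, idealOrder J y ≤ μ) {x : X}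
    (hno : ∀ x' : X', π x' = x → ¬ IsNear π (vanishingIdeal Y) J μ x') {z : X}
    (hz : idealOrder J z = μ) (hzx : z ⤳ x) : z ∈ (Y : Set X) := by
  by_contra hzY
  obtain ⟨x', hx', hnear⟩ :=
    hπ.exists_isNear_of_idealOrder_eq_of_specializes hX hJ2 hreg hJ hY hJμ hzY hz hzx
  exact hno x' hx' hnear

/-- **[CoP1] Lemma 4.3 (2), second sentence: "Moreover `Y` and `Σ` coincide locally at `x`."**
Let `X` be integral, regular, Noetherian with J-2 affine rings (a stage), `J ≠ 0` with
`ord J ≤ μ` on `X` (`μ ≥ 1`), `Y ⊆ Σ = {ord = μ}` a regular centre whose ideal at `x` is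
generated by two members of a regular system of parameters (a curve through `x`), `π` a blowing
up along `Y`, and `τ(x) ≥ 2`. Then every point `z ∈ Σ` specializing to `x` lies on `Y`.
[cite: CossartPiltant2008, Lemma 4.3 (2)] -/
theorem IsBlowup.mem_centre_of_idealOrder_eq_of_specializes [IsIntegral X] [IsNoetherian X]
    (hX : Scheme.IsRegular X) (hJ2 : ∀ U : X.affineOpens, IsJ2Ring Γ(X, U)) {Y : Closeds X}
    (hreg : Scheme.IsRegular (vanishingIdeal Y).subscheme) (hπ : IsBlowup π (vanishingIdeal Y))
    {J : X.IdealSheafData} (hJ : J ≠ ⊥) {μ : ℕ} (hμ : 1 ≤ μ)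
    (hY : ∀ y ∈ (Y : Set X), idealOrder J y = μ) (hJμ : ∀ y : X, idealOrder J y ≤ μ) {x : X}
    [IsRegularLocalRing (X.presheaf.stalk x)] {c : Fin 2 → X.presheaf.stalk x}
    (hcr : IsRsopPart c) (hcY : Ideal.span (Set.range c) = stalkIdeal (vanishingIdeal Y) x)
    (hτ : 2 ≤ stalkTau J x μ) {z : X} (hz : idealOrder J z = μ) (hzx : z ⤳ x) :
    z ∈ (Y : Set X) := by
  haveI : IsProper π := hπ.isProper
  haveI : IsLocallyNoetherian X' := LocallyOfFiniteType.isLocallyNoetherian π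
  refine hπ.mem_centre_of_forall_not_isNear hX hJ2 hreg hJ hY hJμ (fun x' hx' => ?_) hz hzx
  subst hx'
  exact hπ.not_isNear_of_two_le_stalkTau hX hreg hμ hY hcr hcY hτ

end Literature.AlgebraicGeometry.Resolution

end
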